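import Summits.Ventures.PercRepro.Night2OneFatCaseOneSevenB

/-!
# PercRepro — the seven-point shape (i): the STRUCTURE of the target (night-2, gen 30)

A seven-point one-coloop target: `V = S ∖ K` of rank `5` with `coloops V = {w}` and `|V| = 7`, carrying two DISJOINT
collinear triples `R₁`, `R₂` (the open case of `dload_gt_le_cap2_of_card_coloops_le_one''`).  Then `V = {w} ∪ R₁ ∪ R₂`
(`shapeOne_eq_insert`), and for a point `y` of `R₁` the erasure `V ∖ y` has rank `5` and the two other points of `R₁`
as coloops (`mem_coloops_erase_of_line`): `(V ∖ y) ∖ a ⊆ {w} ∪ (R₁ ∖ {y, a}) ∪ R₂` has rank at most `1 + 1 + 2 = 4`.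
These are the hypotheses `hcol` of the case-1 machinery (`closureProp_faces`, `card_sdiff_clF_face_pair`,
`coloops_eq_triple`) applied to each line in turn (proofs/NIGHT-2-g30.md §5).
-/

namespace PercRepro.Shadow

open Finset PerFlat ThmH

variable {α : Type*} [DecidableEq α] {M : Matroid α} [M.Finite]

section Structure

/-- The seven points are the coloop and the two lines. -/
theorem shapeOne_eq_insert {V : Finset α} (h7 : V.card = 7) {w : α} (hw : w ∈ V) {R₁ R₂ : Finset α}
    (hR₁ : R₁ ⊆ V) (hR₂ : R₂ ⊆ V) (h₁ : R₁.card = 3) (h₂ : R₂.card = 3) (hdis : Disjoint R₁ R₂) (hw₁ : w ∉ R₁)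
    (hw₂ : w ∉ R₂) : V = insert w (R₁ ∪ R₂) := by
  symm
  apply Finset.eq_of_subset_of_card_le
  · exact Finset.insert_subset hw (Finset.union_subset hR₁ hR₂)
  · rw [Finset.card_insert_of_notMem (by rw [Finset.mem_union]; push Not; exact ⟨hw₁, hw₂⟩),
      Finset.card_union_of_disjoint hdis, h₁, h₂, h7]

/-- The rank of `{w} ∪ X ∪ R` is at most `1 + |X| + rk R`. -/
theorem rkN_insert_union_le {X R : Finset α} (w : α) :
    rkN M (insert w (X ∪ R)) ≤ 1 + X.card + rkN M R := by
  have h1 : rkN M (insert w (X ∪ R)) ≤ rkN M (X ∪ R) + ({w} : Finset α).card := by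
    rw [Finset.insert_eq, Finset.union_comm]
    exact rkN_union_le_rkN_add_card _ _
  have h2 : rkN M (X ∪ R) ≤ rkN M R + X.card := by
    rw [Finset.union_comm]
    exact rkN_union_le_rkN_add_card _ _
  rw [Finset.card_singleton] at h1
  omega

/-- **The two other points of a line are coloops of the erasure.** For `y ≠ a` in the collinear triple `R₁`,
`a ∈ coloops (V ∖ y)`: `(V ∖ y) ∖ a ⊆ {w} ∪ (R₁ ∖ {y, a}) ∪ R₂` has rank `≤ 4 < 5 = rk (V ∖ y)`. -/
theorem mem_coloops_erase_of_line (hs : ∀ e ∈ gr M, ∀ f ∈ gr M, e ≠ f → rkN M {e, f} = 2) {V : Finset α}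
    (hVg : V ⊆ gr M) (hV5 : rkN M V = 5) (h7 : V.card = 7) {w : α} (hc : coloops M V = {w}) {R₁ R₂ : Finset α}
    (hR₁ : R₁ ⊆ V) (hR₂ : R₂ ⊆ V) (h₁ : R₁.card = 3) (h₂ : R₂.card = 3) (hr₁ : rkN M R₁ = 2) (hr₂ : rkN M R₂ = 2)
    (hdis : Disjoint R₁ R₂) {y a : α} (hy : y ∈ R₁) (ha : a ∈ R₁) (hya : y ≠ a) :
    a ∈ coloops M (V.erase y) := by
  have hwV : w ∈ V := by
    have : w ∈ coloops M V := by rw [hc]; exact Finset.mem_singleton_self _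
    exact (mem_coloops.1 this).1
  have hw₁ : w ∉ R₁ := notMem_line_of_mem_coloops hs hVg (by rw [hc]; exact Finset.mem_singleton_self _) hR₁ h₁ hr₁
  have hw₂ : w ∉ R₂ := notMem_line_of_mem_coloops hs hVg (by rw [hc]; exact Finset.mem_singleton_self _) hR₂ h₂ hr₂
  have hV := shapeOne_eq_insert h7 hwV hR₁ hR₂ h₁ h₂ hdis hw₁ hw₂
  have hyV : y ∈ V := hR₁ hy
  have haV : a ∈ V := hR₁ ha
  have hyw : y ≠ w := fun h => hw₁ (h ▸ hy)
  have haw : a ≠ w := fun h => hw₁ (h ▸ ha)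
  -- `y` is not a coloop of `V`, so the erasure keeps the rank `5`
  have hyc : y ∉ coloops M V := by rw [hc, Finset.mem_singleton]; exact hyw
  have h5 : rkN M (V.erase y) = 5 := by rw [rkN_erase_of_not_coloop hVg hyV hyc]; exact hV5
  -- the double erasure has rank at most `4`
  have hsub : (V.erase y).erase a ⊆ insert w (((R₁.erase y).erase a) ∪ R₂) := by
    intro x hx
    rw [Finset.mem_erase, Finset.mem_erase] at hx
    obtain ⟨hxa, hxy, hxV⟩ := hx
    rw [hV, Finset.mem_insert, Finset.mem_union] at hxV
    rw [Finset.mem_insert, Finset.mem_union, Finset.mem_erase, Finset.mem_erase]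
    tauto
  have hle4 : rkN M ((V.erase y).erase a) ≤ 4 := by
    have h1 := rkN_mono (M := M) hsub
    have h2 := rkN_insert_union_le (M := M) (X := (R₁.erase y).erase a) (R := R₂) w
    have h3 : ((R₁.erase y).erase a).card ≤ 1 := by
      rw [Finset.card_erase_of_mem (Finset.mem_erase.2 ⟨hya.symm, ha⟩), Finset.card_erase_of_mem hy, h₁]
    omega
  rw [mem_coloops]
  refine ⟨Finset.mem_erase.2 ⟨hya.symm, haV⟩, fun hcl => ?_⟩
  have hFg : (V.erase y).erase a ⊆ gr M := (Finset.erase_subset _ _).trans ((Finset.erase_subset _ _).trans hVg)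
  have h1 := rkN_insert_le_of_mem_clF hFg hcl
  rw [Finset.insert_erase (Finset.mem_erase.2 ⟨hya.symm, haV⟩)] at h1
  omega

/-- The erasure of a line point has rank `5`. -/
theorem rkN_erase_eq_five_of_line (hs : ∀ e ∈ gr M, ∀ f ∈ gr M, e ≠ f → rkN M {e, f} = 2) {V : Finset α}
    (hVg : V ⊆ gr M) (hV5 : rkN M V = 5) {w : α} (hc : coloops M V = {w}) {R₁ : Finset α} (hR₁ : R₁ ⊆ V)
    (h₁ : R₁.card = 3) (hr₁ : rkN M R₁ = 2) {y : α} (hy : y ∈ R₁) : rkN M (V.erase y) = 5 := by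
  have hw₁ : w ∉ R₁ := notMem_line_of_mem_coloops hs hVg (by rw [hc]; exact Finset.mem_singleton_self _) hR₁ h₁ hr₁
  have hyc : y ∉ coloops M V := by rw [hc, Finset.mem_singleton]; exact fun h => hw₁ (h ▸ hy)
  rw [rkN_erase_of_not_coloop hVg (hR₁ hy) hyc]; exact hV5

/-- A line point is not a coloop of `V`. -/
theorem notMem_coloops_of_mem_line (hs : ∀ e ∈ gr M, ∀ f ∈ gr M, e ≠ f → rkN M {e, f} = 2) {V : Finset α}
    (hVg : V ⊆ gr M) {w : α} (hc : coloops M V = {w}) {R₁ : Finset α} (hR₁ : R₁ ⊆ V) (h₁ : R₁.card = 3)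
    (hr₁ : rkN M R₁ = 2) {y : α} (hy : y ∈ R₁) : y ∉ coloops M V := by
  have hw₁ : w ∉ R₁ := notMem_line_of_mem_coloops hs hVg (by rw [hc]; exact Finset.mem_singleton_self _) hR₁ h₁ hr₁
  rw [hc, Finset.mem_singleton]; exact fun h => hw₁ (h ▸ hy)

end Structure

end PercRepro.Shadow
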